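import Mathlib
import HarnessLib
import Summits.Langlands.Statement
import Summits.Langlands.Langlands.Theses.DepthPrimeSplit
import Summits.Langlands.Langlands.Theses.WeightMultiplicitySplit
import Summits.Langlands.Langlands.Theorems.WeightMultiplicitySplitMinusculeHodgeType
import Literature.NumberTheory.GaloisRepresentations.LabelledHodgeTateWeights
import Literature.NumberTheory.PAdicHodge.FontaineDpst
import Literature.NumberTheory.GaloisRepresentations.LabelledWeightsDeRhamRank
import Summits.Langlands.Langlands.Theses.ClassicalityWeightSplit
set_option linter.dupNamespace false
set_option linter.unusedVariables false

/-!
# Birth skeleton (BC3) for crux `ClassicalityWeightSplit.RegularClassicality` — line `birth` (AFTER-BIRTH form: the route decl BY NAME)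

Route `ClassicalityWeightSplit` (decomp-langlands lens-2 g17; child route at `DepthPrimeSplit.Classicality` stmt-Langlands-25026).  The crux is
the REGULAR (generic) chamber of CLASS (all labelled Hodge–Tate multiplicities ≤ 1): cut by RANK into n ≤ 2 (GL₁: class field theory; GL₂/ℚ: Kisin 2003 / Emerton 2011 Thm 1.2.4 / Pan II = tree fact `Literature.NumberTheory.Automorphic.Pan2022_proModularDeRhamClassical_GL2Q`) and n ≥ 3 (Breuil–Hellmann–Schraen 2019, Breuil–Ding 2023 for polarisable crystalline generic points; IDEA-NEEDED beyond).

Shape (for `ledger skeleton check` / `#h21_check_skeleton`): stubs `theorem stub_<name> : <signature> := by sorry` (each a layer-2 SUB-BOX of the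
cell: the cell's text VERBATIM with ONE rank clause after `0 < n →` — and, for the degenerate cell at rank ≥ 3, the isotypic sub-dial — so no stub
restates the cell, the target CLASS or the summit: probes B6 of the node kit), `namespace _Goal` with `def stub_<name> : Prop := type_of% @stub_<name>`
naming each statement, and the kernel-checked composition `RegularClassicality_of (h₁ : _Goal.stub_…) … : <the crux BY NAME>` (seam =
`omega` on the rank).  `lean check --json`: rc 0, sorries = the stubs (2 or 3), none elsewhere.
After birth this AFTER-BIRTH form (route decl BY NAME via `import Summits.Langlands.Langlands.Theses.ClassicalityWeightSplit`) is published with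
`ledger crux write <item> Lines/birth.lean --file <this file>` + `ledger skeleton check $(ledger crux dir <item>)/Lines/birth.lean --crux <item>`.
-/

namespace Summit.Langlands.Langlands.Cruxes.RegularClassicality.Birth

open scoped NumberField
open Filter IsDedekindDomain Literature.NumberTheory.GaloisRepresentations
open Summit.Langlands.Langlands.Theorems.WeightMultiplicitySplitMinusculeHodgeType (HodgeTateMultLE IsWallHT)

-- the crux BY NAME: `Summit.Langlands.Langlands.Theses.ClassicalityWeightSplit.RegularClassicality` (the born route file).

/-- RANK BOUND (tree theorem `FramedGaloisRep.card_labelledHodgeTateWeightsAt_eq_of_isDeRhamFramed`: de Rham for the pinned datum ⟹ exactly `n`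
labelled weights at every label): every labelled multiplicity of a rank-`n` `ρ` de Rham above `ℓ` is `≤ k` whenever `n ≤ k`. -/
theorem hodgeTateMultLE_of_rank_le {K : Type} [Field K] [NumberField K] {n ℓ : ℕ} [Fact ℓ.Prime]
    {ρ : FramedGaloisRep K (PadicAlgCl ℓ) n}
    (hdR : ∀ (v : HeightOneSpectrum (𝓞 K)) (hv : ((ℓ : ℕ) : 𝓞 K) ∈ v.asIdeal),
      (Literature.NumberTheory.PAdicHodge.fontainePstAdicCompletion v ℓ hv).IsDeRhamFramed (ρ.toLocal v))
    {k : ℕ} (hk : n ≤ k) : HodgeTateMultLE k ρ :=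
  fun v hv τ hτ w =>
    ((Multiset.count_le_card w _).trans (FramedGaloisRep.card_labelledHodgeTateWeightsAt_eq_of_isDeRhamFramed ρ v hv (hdR v hv) τ hτ).le).trans hk

/-- stub · `stub_regularRankLeTwo` — CG at rank ≤ 2: a pro-automorphic irreducible pinned-geometric `ρ` of rank ≤ 2 with distinct labelled Hodge–Tate weights is weakly automorphic.  Why plausibly true: n = 1 is class field theory + continuity of the reciprocity map (the ℓ-adic limit of algebraic Hecke characters matching ρ to all depths is an algebraic Hecke character: conductors bounded by wild-inertia rigidity I-g17.1(b)); n = 2, K = ℚ is the tree fact `Pan2022_proModularDeRhamClassical_GL2Q` (Pan II Thm 1.1 / Emerton 1.2.4 / Kisin) modulo the dictionary I-g17.1/2; totally real K: Jiang 2026 (T-regular de Rham pro-modular ⟹ classical).  Why it might fail: general K (no eigenvariety with classical points dense is known to see ρ).  Size: L (ℚ, totally real) / XL (general K). -/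
theorem stub_regularRankLeTwo :
    ∀ (K : Type) [Field K] [NumberField K] (n : ℕ) (hcpt : Literature.NumberTheory.Automorphic.isCompact_glFiniteIntegralLevel n K), 0 < n → n ≤ 2 → ∀ (ℓ : ℕ) [Fact ℓ.Prime] (ι : PadicAlgCl ℓ ≃+* ℂ) (ρ : Literature.NumberTheory.GaloisRepresentations.FramedGaloisRep K (PadicAlgCl ℓ) n), ρ.toGaloisRep.IsIrreducible → ((∀ᶠ v : IsDedekindDomain.HeightOneSpectrum (NumberField.RingOfIntegers K) in cofinite, ρ.IsUnramifiedAt v) ∧ ∀ (v : IsDedekindDomain.HeightOneSpectrum (NumberField.RingOfIntegers K)) (hv : ((ℓ : ℕ) : NumberField.RingOfIntegers K) ∈ v.asIdeal), (Literature.NumberTheory.PAdicHodge.fontainePstAdicCompletion v ℓ hv).IsDeRhamFramed (ρ.toLocal v)) → Summit.Langlands.Langlands.Theorems.WeightMultiplicitySplitMinusculeHodgeType.HodgeTateMultLE 1 ρ → (∃ S : Set (IsDedekindDomain.HeightOneSpectrum (NumberField.RingOfIntegers K)), S.Finite ∧ ∀ r : NNReal, 0 < r → ∃ π : Literature.NumberTheory.Automorphic.CuspidalAutomorphicRepData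 n K hcpt, π.1.IsLAlgebraic ∧ ∀ v : IsDedekindDomain.HeightOneSpectrum (NumberField.RingOfIntegers K), v ∉ S → (∃ α : Multiset ℂ, π.1.HasSatakeParamAt v α ∧ ∀ 𝔓 ∈ v.primesAbove, ∀ σ : Field.absoluteGaloisGroup K, IsArithFrobAt (NumberField.RingOfIntegers K) σ 𝔓 → ∀ i : ℕ, Valued.v ((Literature.NumberTheory.GaloisRepresentations.FramedRep.charpoly ρ σ - Literature.NumberTheory.Automorphic.arithFrobPolyOfSatake ι v.residueCard 1 α).coeff i) < r)) → ∃ π : Literature.NumberTheory.Automorphic.CuspidalAutomorphicRepData n K hcpt, π.1.IsLAlgebraic ∧ ∀ᶠ v : IsDedekindDomain.HeightOneSpectrum (NumberField.RingOfIntegers K) in cofinite, SatakeFrobCompatibleAt ι π.1 ρ v := by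
  sorry

/-- stub · `stub_regularRankGeThree` — CG at rank ≥ 3: regular pro-automorphic ⟹ weakly automorphic on GL_n, n ≥ 3.  Why plausibly true: classicality of regular (numerically non-critical, generic) points of eigenvarieties — BHS 2019 (crystalline generic, polarisable over CM), Breuil–Ding 2023 — plus patched-eigenvariety density; the regular chamber is where every catalogued classicality engine applies.  Why it might fail: non-polarisable ρ / l₀ > 0 (no eigenvariety of the right dimension: TaylorWilesNumericalCoincidence), critical-slope refinements.  Size: XL. -/
theorem stub_regularRankGeThree :
    ∀ (K : Type) [Field K] [NumberField K] (n : ℕ) (hcpt : Literature.NumberTheory.Automorphic.isCompact_glFiniteIntegralLevel n K), 0 < n → 3 ≤ n → ∀ (ℓ : ℕ) [Fact ℓ.Prime] (ι : PadicAlgCl ℓ ≃+* ℂ) (ρ : Literature.NumberTheory.GaloisRepresentations.FramedGaloisRep K (PadicAlgCl ℓ) n), ρ.toGaloisRep.IsIrreducible → ((∀ᶠ v : IsDedekindDomain.HeightOneSpectrum (NumberField.RingOfIntegers K) in cofinite, ρ.IsUnramifiedAt v) ∧ ∀ (v : IsDedekindDomain.HeightOneSpectrum (NumberField.RingOfIntegers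 K)) (hv : ((ℓ : ℕ) : NumberField.RingOfIntegers K) ∈ v.asIdeal), (Literature.NumberTheory.PAdicHodge.fontainePstAdicCompletion v ℓ hv).IsDeRhamFramed (ρ.toLocal v)) → Summit.Langlands.Langlands.Theorems.WeightMultiplicitySplitMinusculeHodgeType.HodgeTateMultLE 1 ρ → (∃ S : Set (IsDedekindDomain.HeightOneSpectrum (NumberField.RingOfIntegers K)), S.Finite ∧ ∀ r : NNReal, 0 < r → ∃ π : Literature.NumberTheory.Automorphic.CuspidalAutomorphicRepData n K hcpt, π.1.IsLAlgebraic ∧ ∀ v : IsDedekindDomain.HeightOneSpectrum (NumberField.RingOfIntegers K), v ∉ S → (∃ α : Multiset ℂ, π.1.HasSatakeParamAt v α ∧ ∀ 𝔓 ∈ v.primesAbove, ∀ σ : Field.absoluteGaloisGroup K, IsArithFrobAt (NumberField.RingOfIntegers K) σ 𝔓 → ∀ i : ℕ, Valued.v ((Literature.NumberTheory.GaloisRepresentations.FramedRep.charpoly ρ σ - Literature.NumberTheory.Automorphic.arithFrobPolyOfSatake ι v.residueCard 1 α).coeff i) < r)) → ∃ π : Literature.NumberTheory.Automorphic.CuspidalAutomorphicRepData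 n K hcpt, π.1.IsLAlgebraic ∧ ∀ᶠ v : IsDedekindDomain.HeightOneSpectrum (NumberField.RingOfIntegers K) in cofinite, SatakeFrobCompatibleAt ι π.1 ρ v := by
  sorry

namespace _Goal

/-- the statement of `stub_regularRankLeTwo` as a named Prop. -/
def stub_regularRankLeTwo : Prop :=
  type_of% @Summit.Langlands.Langlands.Cruxes.RegularClassicality.Birth.stub_regularRankLeTwo

/-- the statement of `stub_regularRankGeThree` as a named Prop. -/
def stub_regularRankGeThree : Prop :=
  type_of% @Summit.Langlands.Langlands.Cruxes.RegularClassicality.Birth.stub_regularRankGeThree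

end _Goal

/-- **`RegularClassicality` from the two stubs** (kernel-checked, no sorry): the hypotheses are, by name, the statements of the stubs; the conclusion is the route decl `Summit.Langlands.Langlands.Theses.ClassicalityWeightSplit.RegularClassicality`; seam = `omega` on the rank. -/
theorem RegularClassicality_of (h1 : _Goal.stub_regularRankLeTwo) (h2 : _Goal.stub_regularRankGeThree) :
    Summit.Langlands.Langlands.Theses.ClassicalityWeightSplit.RegularClassicality := by
  have ha : type_of% @stub_regularRankLeTwo := h1
  have hb : type_of% @stub_regularRankGeThree := h2
  intro K _ _ n hcpt hn ℓ _ ι ρ hirr hgeo hr hpro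
  rcases Nat.lt_or_ge n 3 with hlt | hge
  · exact ha K n hcpt hn (by omega) ℓ ι ρ hirr hgeo hr hpro
  · exact hb K n hcpt hn hge ℓ ι ρ hirr hgeo hr hpro

/-- By-name sanity check (an `example`, not a declaration of the file): the stubs feed the composition as they stand. -/
example : Summit.Langlands.Langlands.Theses.ClassicalityWeightSplit.RegularClassicality :=
  RegularClassicality_of stub_regularRankLeTwo stub_regularRankGeThree

/-- Hypothesis-free assembly (operator recipe 2026-08-30T22:10Z for `skeleton check`: a theorem concluding the crux BY NAME, assembled from the
sorried `stub_*` theorems — it inherits their `sorry`, nothing else). -/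
theorem RegularClassicality_proof : Summit.Langlands.Langlands.Theses.ClassicalityWeightSplit.RegularClassicality :=
  RegularClassicality_of stub_regularRankLeTwo stub_regularRankGeThree

end Summit.Langlands.Langlands.Cruxes.RegularClassicality.Birth
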